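import Summits.HodgeConjecture.HodgeConjecture.Theorems.LimitExtensionHypersurfaceHodgeFourLowDegreeOfGysin
import Literature.AlgebraicGeometry.HodgeTheory.ComplexOrientationCycleClassFacts

/-!
# Route LimitExtension — `HypersurfaceHodgeFourLowDegree` (item stmt-HodgeConjecture-3003), X:
# the Gysin / cycle-class formalism CONSTRUCTED — the item from Fulton's Lemma 19.1.2 and Voisin's
# Lemma 9.18 for the complex orientations

Helper file for the support item `HypersurfaceHodgeFourLowDegree` of route
`HodgeConjecture/LimitExtension` (`∀ d ≤ 5, ∀ X, IsSmoothHypersurface 4 d X → HodgeConjectureFor 4 X`).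
File IX (`…OfGysin`) left the item granted `(G : GysinFormalism) (hG : G.IsGysinHodgeCompatible)`
ALONE — a hypothesis STRUCTURE (Gysin morphisms and cycle classes on `H*(–(ℂ); ℂ)` with eight printed
properties) for which the tree had no instance: the Gysin half was constructed (`complexGysin μ`), the
cycle-class half was not.

The cycle-class half is now constructed in `Literature/AlgebraicGeometry/HodgeTheory/`:

* `CycleClassOfResolutions` — Voisin I §11.1.4 as REAL data: resolution families (exist by the
  theorem `Resolution.Hironaka1964_projective_holds`), `cycleClass μ hX hde ρ : Z_d(X) →+ H^{2e}(X(ℂ); ℂ)`,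
  `[Z] = Σ_z Z(z) • τ_z* 1`, with its support property PROVED;
* `CycleClassPushforward` — `[ι(V)] = ι_* 1`, independence of the resolutions and
  `[f_* Z] = f_* [Z]` (Prop. 9.21 (ii)) PROVED from the degree formula for `μ`;
* `GysinFormalismOfResolutions` — `cl_congr` from Lemma 9.18 for `μ`, rationality of `complexGysin μ`
  for `μ` with rational fundamental classes, and the THEOREM
  `exists_gysinFormalism_isGysinHodgeCompatible`: a Hodge-compatible `GysinFormalism` exists for every
  such `μ`;
* `ComplexOrientationFamily` — the complex orientation family (the atlas of holomorphic algebraic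
  charts of `X(ℂ)` is positive, PROVED; `positiveAtlasOrientation`; rational fundamental classes PROVED);
* `ComplexOrientationCycleClassFacts` — the two classical identities for the complex orientations as
  NAMED FACTS: `Fulton1998_degreeFormula_complexOrientation` (Fulton, *Intersection Theory*,
  Lemma 19.1.2: `f_* cl(V) = deg(V/W) cl(W)`) and `Voisin2003_cycleClass_div_eq_zero_complexOrientation`
  (Voisin II, Lemma 9.18: `[Z] = 0` for `Z ∼_rat 0`, generator form).

Hence:

* `limitExtension_hypersurfaceHodgeFourLowDegree_of_orientationFamily` — **the item for ANY
  orientation family with rational fundamental classes satisfying the degree formula and Lemma 9.18**;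
* `limitExtension_hypersurfaceHodgeFourLowDegree_of_complexOrientation` — **the item from the two named
  facts `Fulton1998_degreeFormula_complexOrientation`, `Voisin2003_cycleClass_div_eq_zero_complexOrientation`
  ALONE** (conditional result; the item's residue on the tree's trust base is now exactly these two
  published theorems about the real maps `complexGysin complexOrientationFamily`, every construction
  being done);
* the Conte–Murre and Zucker named facts, and Voisin II Prop. 10.26 (Bloch–Srinivas), from the same two
  facts.

No `sorry`, no definition, no new named fact in this file.

## References

* [Fulton1998] W. Fulton, Intersection Theory, 2nd ed. (1998), Lemma 19.1.2, §19.1.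
* [VoisinHodgeII2003] C. Voisin, Hodge Theory and Complex Algebraic Geometry II (CUP 2003), Lemma 9.18,
  Prop. 9.21 (ii), Prop. 10.26 and its proof (§10.2.3, p. 306).
* [VoisinHodgeI2002] C. Voisin, Hodge Theory and Complex Algebraic Geometry I (CUP 2002), §7.3.2, §11.1.4.
* [ConteMurre1978] A. Conte, J. P. Murre, Math. Ann. 238 (1978) 79–88 (cite-only).
* [Zucker1977] S. Zucker, Compositio Math. 34 (1977) 199–209 (cite-only).
-/

-- `Summit.HodgeConjecture.HodgeConjecture.Theorems` is the mandated namespace (single-problem summit: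
-- Problem = Summit), which `linter.dupNamespace` flags on every declaration; the lakefile turns the
-- linter off tree-wide (weak option), restated here so stand-alone elaboration is warning-free too.
set_option linter.dupNamespace false

noncomputable section

namespace Summit.HodgeConjecture.HodgeConjecture.Theorems

open CategoryTheory AlgebraicGeometry
open Literature.AlgebraicGeometry.HodgeTheory Literature.AlgebraicGeometry.Motives
  Literature.Barriers.HodgeConjecture Literature.AlgebraicGeometry

/-- **`HypersurfaceHodgeFourLowDegree` for every orientation family with rational fundamental classes
satisfying the degree formula and Lemma 9.18.** A Hodge-compatible Gysin / cycle-class formalism exists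
for such a family (`exists_gysinFormalism_isGysinHodgeCompatible`: Gysin maps `complexGysin μ`, cycle
classes through desingularisations), and the item follows from any such formalism
(`limitExtension_hypersurfaceHodgeFourLowDegree_of_gysin`, file IX).
[cite: VoisinHodgeII2003, Prop. 10.26 and its proof (§10.2.3, p. 306)] [cite: Fulton1998, Lemma 19.1.2]
[cite: VoisinHodgeII2003, Lemma 9.18] -/
theorem limitExtension_hypersurfaceHodgeFourLowDegree_of_orientationFamily (μ : OrientationFamily)
    (hR : μ.HasRationalFundamentalClasses) (hB : μ.HasDegreeFormula) (hC : μ.CycleClassDivEqZero) :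
    Theses.LimitExtension.HypersurfaceHodgeFourLowDegree := by
  obtain ⟨G, hG, -, -⟩ := exists_gysinFormalism_isGysinHodgeCompatible hB hC hR
  exact limitExtension_hypersurfaceHodgeFourLowDegree_of_gysin G hG

/-- **`HypersurfaceHodgeFourLowDegree` from Fulton's Lemma 19.1.2 and Voisin's Lemma 9.18 for the
complex orientations ALONE.** The Hodge conjecture holds for every smooth hypersurface fourfold of degree
`d ≤ 5`, granted the named facts `Fulton1998_degreeFormula_complexOrientation` (`g_* 1_V = deg • τ_* 1`
for the complex orientation family) and `Voisin2003_cycleClass_div_eq_zero_complexOrientation`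
(`[div φ] = 0`): the complex orientation family has rational fundamental classes
(`hasRationalFundamentalClasses_complexOrientationFamily`, a theorem), so
`limitExtension_hypersurfaceHodgeFourLowDegree_of_orientationFamily` applies. Every other ingredient
of the item — the `CH₀`-inputs for `1 ≤ d ≤ 5`, the decomposition of the diagonal, projective Hironaka,
Hodge models, Lefschetz `(1,1)`, hard Lefschetz, the other codimensions, the Gysin morphisms with
functoriality / projection formula / support / Hodge compatibility, the cycle classes with support /
`[ι(V)] = ι_* 1` / `[f_* Z] = f_* [Z]`, the complex orientations — is a theorem of the tree.
[cite: VoisinHodgeII2003, Prop. 10.26 and its proof (§10.2.3, p. 306)] [cite: Fulton1998, Lemma 19.1.2]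
[cite: VoisinHodgeII2003, Lemma 9.18] [cite: ConteMurre1978] [cite: Zucker1977] -/
theorem limitExtension_hypersurfaceHodgeFourLowDegree_of_complexOrientation
    (hB : Fulton1998_degreeFormula_complexOrientation)
    (hC : Voisin2003_cycleClass_div_eq_zero_complexOrientation) :
    Theses.LimitExtension.HypersurfaceHodgeFourLowDegree :=
  limitExtension_hypersurfaceHodgeFourLowDegree_of_orientationFamily complexOrientationFamily
    hasRationalFundamentalClasses_complexOrientationFamily hB hC

/-- **Voisin II, Prop. 10.26 (Bloch–Srinivas) from the two named facts**: for every smooth projective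
complex fourfold with `CH₀` supported in dimension `≤ 3`, every rational `(2,2)`-class is algebraic.
[cite: VoisinHodgeII2003, Prop. 10.26 and its proof (§10.2.3, p. 306)] [cite: Fulton1998, Lemma 19.1.2]
[cite: VoisinHodgeII2003, Lemma 9.18] -/
theorem limitExtension_blochSrinivas_of_complexOrientation
    (hB : Fulton1998_degreeFormula_complexOrientation)
    (hC : Voisin2003_cycleClass_div_eq_zero_complexOrientation) :
    BlochSrinivas1983_hodgeConjectureDegreeFour_of_chowZeroSupported := by
  obtain ⟨G, hG, -, -⟩ := exists_gysinFormalism_isGysinHodgeCompatible_complexOrientation hB hC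
  exact BlochSrinivas1983_hodgeConjectureDegreeFour_of_chowZeroSupported_of_gysinHodgeCompatible G hG

/-- **The Conte–Murre named fact from the two named facts**: every rational `(2,2)`-class on a smooth
quartic or quintic fourfold is algebraic. [cite: ConteMurre1978]
[cite: VoisinHodgeII2003, Prop. 10.26 and the remark following it (§10.2.3)] -/
theorem limitExtension_hodgeTwoTwo_algebraic_quarticQuinticFourfold_of_complexOrientation
    (hB : Fulton1998_degreeFormula_complexOrientation)
    (hC : Voisin2003_cycleClass_div_eq_zero_complexOrientation) :
    hodgeTwoTwo_algebraic_quarticQuinticFourfold :=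
  limitExtension_hodgeTwoTwo_algebraic_quarticQuinticFourfold_of_blochSrinivas
    (limitExtension_blochSrinivas_of_complexOrientation hB hC)

/-- **Zucker's named fact from the two named facts**: every rational `(2,2)`-class on a smooth cubic
fourfold is algebraic. [cite: Zucker1977] [cite: VoisinHodgeII2003, Prop. 10.26 and the remark following it (§10.2.3)] -/
theorem limitExtension_hodgeTwoTwo_algebraic_cubicFourfold_of_complexOrientation
    (hB : Fulton1998_degreeFormula_complexOrientation)
    (hC : Voisin2003_cycleClass_div_eq_zero_complexOrientation) : hodgeTwoTwo_algebraic_cubicFourfold :=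
  fun _ hX c hc h22 ↦ limitExtension_twoTwo_of_hypersurfaceHodgeFourLowDegree
    (limitExtension_hypersurfaceHodgeFourLowDegree_of_complexOrientation hB hC) (by norm_num) hX c hc h22

end Summit.HodgeConjecture.HodgeConjecture.Theorems

end
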